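import Mathlib
import Summits.AtomisticToContinuum.Crystallization.Theorems.IsometryAtomsMinimisingLawsCohesiveMeasurableClassAux1
import Summits.AtomisticToContinuum.Crystallization.Theorems.IsometryAtomsMinimisingLawsCohesiveMeasurableClassAux2

/-!
# Stub `stub_measurableClass` of line `purity_stacking` — crux `IsometryAtoms.MinimisingLawsCohesive`
# (stmt-AtomisticToContinuum-15777)

**Giry measurability of a single-root congruence class.**  For `δ > 0`, a `δ`-separated
`Y ⊆ ℝ³` and a root `q ∈ ℝ³`, the set of configurations
`K := {count|A(Y - q) : A a linear isometry of ℝ³} ⊆ Measure ℝ³` is measurable for the Giry σ-algebra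
(`MeasureTheory.Measure.instMeasurableSpace`, generated by the evaluations `μ ↦ μ s`).

Proof (finite nets of `O(3)` + separation, no kernels).  Put `W := Y - q` (`δ`-separated) and let
`D : ℕ → O(3)` be dense with compact closure `O(3)` (helper 2, `exists_isometrySeq`).  Then
`K = HardCore δ ∩ ⋂ₙ ⋃ₘ Eₙ(Dₘ)` where `HardCore δ = {count|S : S δ-separated}` is measurable (helper 1,
`measurableClass_hardCore_measurableSet`) and `Eₙ(B)` is the measurable approximate matching event
"`μ (ball (B w) (δ/(n+4))) ≠ 0` for `w ∈ W`, `‖w‖ ≤ n+1`, and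
`μ (closedBall 0 n ∖ ⋃ these balls) = 0`" (helper 2, `measurableSet_event`):
`⊆` because `Dₘ → A` in operator norm moves each atom `A w`, `‖w‖ ≤ n+1`, by `< δ/(n+4)`
(`count_restrict_image_mem_event`); `⊇` because for `μ = count|S` in all `⋃ₘ Eₙ(Dₘ)` a convergent
subsequence `D_{m(φ k)} → A` of the chosen isometries matches `S` with `A(W)` exactly
(`eq_image_of_matching`: limits of eventually constant sequences in the separated closed set `S`, and
finiteness of bounded parts of `W`).
-/

noncomputable section

open MeasureTheory Metric Filter Topology
open scoped ENNReal

namespace Summit.AtomisticToContinuum.Crystallization.Theorems.IsometryAtomsMinimisingLawsCohesive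

open MeasurableClass

/-- **`HardCore δ ∩ ⋂ₙ ⋃ₘ Eₙ(Dₘ) ⊆ K`.**  If `count|S` (`S` `δ`-separated) lies in the approximate matching
events `Eₙ(D (m n))` for all `n`, where along every index sequence `D` has operator-norm convergent
subsequences with isometric limits, then `S = A(W)` for a linear isometry `A`. -/
theorem MeasurableClass.exists_eq_image {δ : ℝ} (hδ : 0 < δ) {W S : Set (EuclideanSpace ℝ (Fin 3))}
    (hW : ∀ x ∈ W, ∀ y ∈ W, x ≠ y → δ ≤ dist x y) (hS : ∀ x ∈ S, ∀ y ∈ S, x ≠ y → δ ≤ dist x y)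
    {D : ℕ → (EuclideanSpace ℝ (Fin 3) →ₗᵢ[ℝ] EuclideanSpace ℝ (Fin 3))}
    (hDcpt : ∀ g : ℕ → ℕ, ∃ A : EuclideanSpace ℝ (Fin 3) →ₗᵢ[ℝ] EuclideanSpace ℝ (Fin 3),
      ∃ φ : ℕ → ℕ, StrictMono φ ∧
        ∀ η : ℝ, 0 < η → ∀ᶠ k in atTop, ∀ x, ‖D (g (φ k)) x - A x‖ ≤ η * ‖x‖)
    (m : ℕ → ℕ)
    (hm : ∀ n : ℕ, (∀ w ∈ {w ∈ W | ‖w‖ ≤ (n : ℝ) + 1},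
        (Measure.count : Measure (EuclideanSpace ℝ (Fin 3))).restrict S
          (ball (D (m n) w) (δ / ((n : ℝ) + 4))) ≠ 0) ∧
      (Measure.count : Measure (EuclideanSpace ℝ (Fin 3))).restrict S
        (closedBall 0 n \ ⋃ w ∈ {w ∈ W | ‖w‖ ≤ (n : ℝ) + 1},
          ball (D (m n) w) (δ / ((n : ℝ) + 4))) = 0) :
    ∃ A : EuclideanSpace ℝ (Fin 3) →ₗᵢ[ℝ] EuclideanSpace ℝ (Fin 3), S = A '' W := by
  have hSmeas : MeasurableSet S := (countable_of_sep hδ hS).measurableSet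
  obtain ⟨A, φ, hφ, hconv⟩ := hDcpt m
  refine ⟨A, eq_image_of_matching hδ hW hS (fun n => D (m n)) A hφ hconv ?_ ?_⟩
  · intro n w hw hwn
    have h := (hm n).1 w ⟨hw, hwn⟩
    rw [Measure.restrict_apply' hSmeas] at h
    obtain ⟨s, hsball, hsS⟩ := Measure.count_ne_zero_iff.1 h
    exact ⟨s, hsS, mem_ball.1 hsball⟩
  · intro n s hs hsn
    have h := (hm n).2
    rw [Measure.restrict_apply' hSmeas, Measure.count_eq_zero_iff] at h
    by_contra hcon
    push Not at hcon
    have hmem : s ∈ (closedBall (0 : EuclideanSpace ℝ (Fin 3)) n \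
        ⋃ w ∈ {w ∈ W | ‖w‖ ≤ (n : ℝ) + 1}, ball (D (m n) w) (δ / ((n : ℝ) + 4))) ∩ S := by
      refine ⟨⟨mem_closedBall_zero_iff.2 hsn, fun hU => ?_⟩, hs⟩
      rw [Set.mem_iUnion₂] at hU
      obtain ⟨w, ⟨hwW, hwn⟩, hsw⟩ := hU
      exact (hcon w hwW hwn).not_gt (mem_ball.1 hsw)
    rw [h] at hmem
    exact hmem

/-- **Stub `stub_measurableClass`** of line `purity_stacking` (crux `IsometryAtoms.MinimisingLawsCohesive`,
stmt-AtomisticToContinuum-15777): **Giry measurability of a single-root congruence class.**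
For `δ > 0`, `Y ⊆ ℝ³` `δ`-separated and `q ∈ ℝ³`, the set
`{count|A(Y - q) : A : ℝ³ →ₗᵢ[ℝ] ℝ³}` of rooted isometric copies of `Y` is measurable in
`Measure ℝ³`.  Proof: it equals `HardCore δ ∩ ⋂ₙ ⋃ₘ Eₙ(Dₘ)` for a dense sequence `D` of `O(3)` and the
approximate matching events `Eₙ` (see the module docstring); consumers take countable unions over the
roots `q ∈ Y`. -/
theorem stub_measurableClass :
    ∀ δ : ℝ, 0 < δ → ∀ Y : Set (EuclideanSpace ℝ (Fin 3)),
      (∀ x ∈ Y, ∀ y ∈ Y, x ≠ y → δ ≤ dist x y) → ∀ q : EuclideanSpace ℝ (Fin 3),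
      MeasurableSet {μ : MeasureTheory.Measure (EuclideanSpace ℝ (Fin 3)) |
        ∃ A : EuclideanSpace ℝ (Fin 3) →ₗᵢ[ℝ] EuclideanSpace ℝ (Fin 3),
          μ = (MeasureTheory.Measure.count : MeasureTheory.Measure (EuclideanSpace ℝ (Fin 3))).restrict
            ((fun s => A (s - q)) '' Y)} := by
  intro δ hδ Y hY q
  set W : Set (EuclideanSpace ℝ (Fin 3)) := (fun s => s - q) '' Y with hW_def
  have hW : ∀ x ∈ W, ∀ y ∈ W, x ≠ y → δ ≤ dist x y := by
    rintro _ ⟨x, hx, rfl⟩ _ ⟨y, hy, rfl⟩ hne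
    rw [dist_sub_right]
    exact hY x hx y hy fun h => hne (by rw [h])
  have himage : ∀ A : EuclideanSpace ℝ (Fin 3) →ₗᵢ[ℝ] EuclideanSpace ℝ (Fin 3),
      (fun s => A (s - q)) '' Y = A '' W := fun A => by
    rw [hW_def, Set.image_image]
  obtain ⟨D, hDdense, hDcpt⟩ := exists_isometrySeq (EuclideanSpace ℝ (Fin 3))
  have hWc : ∀ n : ℕ, ({w ∈ W | ‖w‖ ≤ (n : ℝ) + 1}).Countable := fun n =>
    (countable_of_sep hδ hW).mono fun w hw => hw.1
  have key : {μ : Measure (EuclideanSpace ℝ (Fin 3)) |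
      ∃ A : EuclideanSpace ℝ (Fin 3) →ₗᵢ[ℝ] EuclideanSpace ℝ (Fin 3),
        μ = (Measure.count : Measure (EuclideanSpace ℝ (Fin 3))).restrict
          ((fun s => A (s - q)) '' Y)} =
      {μ : Measure (EuclideanSpace ℝ (Fin 3)) |
        ∃ S : Set (EuclideanSpace ℝ (Fin 3)), (∀ x ∈ S, ∀ y ∈ S, x ≠ y → δ ≤ dist x y) ∧
          μ = (Measure.count : Measure (EuclideanSpace ℝ (Fin 3))).restrict S} ∩
      ⋂ n : ℕ, ⋃ m : ℕ, {μ : Measure (EuclideanSpace ℝ (Fin 3)) |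
        (∀ w ∈ {w ∈ W | ‖w‖ ≤ (n : ℝ) + 1}, μ (ball (D m w) (δ / ((n : ℝ) + 4))) ≠ 0) ∧
          μ (closedBall 0 n \ ⋃ w ∈ {w ∈ W | ‖w‖ ≤ (n : ℝ) + 1},
            ball (D m w) (δ / ((n : ℝ) + 4))) = 0} := by
    refine Set.Subset.antisymm ?_ ?_
    · rintro μ ⟨A, rfl⟩
      rw [himage]
      refine ⟨⟨A '' W, sep_image hW A, rfl⟩, Set.mem_iInter.2 fun n => ?_⟩
      obtain ⟨m, hm⟩ := hDdense A (δ / ((n : ℝ) + 4) / ((n : ℝ) + 2)) (by positivity)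
      exact Set.mem_iUnion.2 ⟨m, count_restrict_image_mem_event hδ hW A (D m) n hm⟩
    · rintro μ ⟨⟨S, hS, rfl⟩, h⟩
      rw [Set.mem_iInter] at h
      choose m hm using fun n => Set.mem_iUnion.1 (h n)
      obtain ⟨A, hA⟩ := exists_eq_image hδ hW hS hDcpt m hm
      exact ⟨A, by rw [himage, ← hA]⟩
  rw [key]
  exact (measurableClass_hardCore_measurableSet δ hδ).inter
    (MeasurableSet.iInter fun n => MeasurableSet.iUnion fun m =>
      measurableSet_event (hWc n) (D m) _ _)

end Summit.AtomisticToContinuum.Crystallization.Theorems.IsometryAtomsMinimisingLawsCohesive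

end
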